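import Literature.Topology.FourManifolds.ToricBlowupModel
import Literature.Topology.FourManifolds.SphereComplexCoordinates
import Literature.Topology.FourManifolds.TorusCoordinates
import HarnessLib

/-!
# The toric model as the blow-up of `S² × ℝ²`: blow-down map, exceptional curve, and the
# involution on the complement of the blown-up point

Second file on the toric model `Ṽ = ToricBlowup.Model` of `Bl_p(ℂℙ¹ × ℂ)`
(`ToricBlowupModel.lean`). Reading `ℂℙ¹` as the round sphere `𝕊 2` through the stereographic
coordinate `ζ` (`SphereComplexCoordinates.lean`) and `ℂ` as the plane `𝔼 2 = ℝ²`, we identify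
`Ṽ` minus its exceptional curve with `B ∖ {p}`, `B = 𝕊 2 × ℝ²`, `p = (N, 0)` (`N` the north
pole, `ζ(N) = ∞`):

* `ToricBlowup.toModel : 𝕊 2 × ℝ² → Model` — `(x, w) ↦ Φ₁ (ζ(x), w)` off the north pole and
  `(N, w) ↦ Φ₃ (0, w)` (junk at `p` itself); `ToricBlowup.blowDown : Model → 𝕊 2 × ℝ²` — the
  blow-down map `π`, a globally smooth map with `blowDown (toModel b) = b` for `b ≠ p`
  (`blowDown_toModel`) collapsing the exceptional curve `ToricBlowup.excep` to `p`
  (`blowDown_eq_basePt_iff`); `toModel (blowDown v) = v` off `excep` (`toModel_blowDown`).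
* `ToricBlowup.toModelPH` — the two maps as an open partial homeomorphism
  `B ∖ {p} ≅ Model ∖ excep`, smooth with smooth inverse (`contMDiffOn_toModel`,
  `contMDiff_blowDown`), whence an open smooth embedding of the open submanifold `B ∖ {p}`.
* `ToricBlowup.twistB (x, w) = (moebius w x, w)` (`w` read as a complex number) and
  **`Ψ (toModel b) = toModel (twistB b)` for `w ≠ 0`** (`Ψ_toModel`): off the central fibre the
  monomial involution `Ψ` of the model is the fibrewise Möbius involution `ζ ↦ (w ζ)⁻¹` of
  `𝕊 2 × (ℝ² ∖ 0)`; and **`gluckMap (twistB (x, w)) = (moebius ‖w‖ x, w)`** (`gluckMap_twistB`):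
  composed with Gluck's map `(x, w) ↦ (rot_{w/‖w‖} x, w)` it becomes the half-turn of `𝕊 2`
  followed by the dilation `ζ ↦ ζ/‖w‖` — a map which no longer winds around the fibre. This is
  the computation behind "the Gluck twist extends over `(S² × D²) # ℂℙ²`".

Sources: the elementary transformation / blow-up charts as in `ToricBlowupModel.lean` (Fulton,
*Introduction to toric varieties*, §§1.1, 2.4); Gluck's map `τ` from Gluck, *The embedding of
two-spheres in the four-sphere*, Trans. AMS 104 (1962), §8 (the tree's `Literature.Topology.FourManifolds.gluckMap`).
-/

noncomputable section

open scoped Manifold ContDiff Topology ComplexConjugate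
open Set Function Metric Module Complex

namespace Literature.Topology.FourManifolds

/-- Local notation: `𝔼 n` is the model Euclidean space `EuclideanSpace ℝ (Fin n)`. -/
local notation "𝔼 " n:arg => EuclideanSpace ℝ (Fin n)

/-- Local notation: `𝕊 n` is the unit sphere in `EuclideanSpace ℝ (Fin (n + 1))`. -/
local notation "𝕊 " n:arg => (Metric.sphere (0 : EuclideanSpace ℝ (Fin (n + 1))) 1)

namespace ToricBlowup

open SphereCoord

/-! ### The plane as the complex line -/

/-! The identification `ℝ² → ℂ`, `w ↦ w₀ + i w₁`, is the tree's `Literature.Topology.FourManifolds.toC`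
(`TorusCoordinates.lean`: `toC_re`, `toC_im`, `contDiff_toC`, `toC_injective`, `norm_toC`); we add
its inverse `planeR` (Mathlib's `Complex.orthonormalBasisOneI.repr`, kept as a plain function with
definitional coordinates) and the few lemmas used below. -/

/-- The plane vector `(Re z, Im z)` of a complex number: the inverse of the tree's `toC`
(`planeR_toC`, `toC_planeR`); as a function it is Mathlib's `Complex.orthonormalBasisOneI.repr` and
the tree's `PlaneComplex.ofC` (`GluckTwistMeridian.lean`, not imported here). [folklore] -/
def planeR (z : ℂ) : 𝔼 2 := WithLp.toLp 2 ![z.re, z.im]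

/-- First coordinate of `planeR`. [folklore] -/
@[simp] theorem planeR_apply_zero (z : ℂ) : planeR z 0 = z.re := rfl

/-- Second coordinate of `planeR`. [folklore] -/
@[simp] theorem planeR_apply_one (z : ℂ) : planeR z 1 = z.im := rfl

/-- `toC (planeR z) = z`. [folklore] -/
@[simp] theorem toC_planeR (z : ℂ) : toC (planeR z) = z := Complex.ext rfl rfl

/-- `planeR (toC w) = w`. [folklore] -/
@[simp] theorem planeR_toC (w : 𝔼 2) : planeR (toC w) = w := by
  ext i; fin_cases i <;> rfl

/-- `|toC w|² = ‖w‖²`. [folklore] -/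
theorem normSq_toC (w : 𝔼 2) : normSq (toC w) = ‖w‖ ^ 2 := by
  rw [normSq_eq_norm_sq, norm_toC]

/-- `toC w = 0 ↔ w = 0`. [folklore] -/
@[simp] theorem toC_eq_zero_iff (w : 𝔼 2) : toC w = 0 ↔ w = 0 := by
  rw [← norm_eq_zero, norm_toC, norm_eq_zero]

/-- `toC 0 = 0`. [folklore] -/
@[simp] theorem toC_zero : toC 0 = 0 := (toC_eq_zero_iff 0).2 rfl

/-- `planeR 0 = 0`. [folklore] -/
@[simp] theorem planeR_zero : planeR 0 = 0 := by rw [← toC_zero, planeR_toC]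

/-- `planeR` is smooth (linear). [folklore] -/
theorem contDiff_planeR : ContDiff ℝ ∞ planeR := by
  unfold planeR
  apply PiLp.contDiff_toLp.comp
  rw [contDiff_pi]
  intro i
  fin_cases i
  · exact Complex.reCLM.contDiff
  · exact Complex.imCLM.contDiff

/-! ### The blown-up point, the inclusion `toModel` and the blow-down map -/

/-- The blown-up point `p = (N, 0)` of `B = 𝕊 2 × ℝ²`. [folklore] -/
def basePt : (𝕊 2) × 𝔼 2 := (northPole, 0)

/-- **The inclusion of `B ∖ {p}` into the model**: `(x, w) ↦ Φ₁ (ζ(x), w)` off the north pole,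
`(N, w) ↦ Φ₃ (0, w)` (the point of the proper transform of the fibre `{ζ = ∞}` over `w`); the
value at `p = (N, 0)` itself is junk. [folklore] -/
def toModel (b : (𝕊 2) × 𝔼 2) : Model :=
  if b.1 = northPole then Φ₃ (0, toC b.2) else Φ₁ (zeta b.1, toC b.2)

/-- `toModel` off the north pole. [folklore] -/
theorem toModel_of_ne_northPole {b : (𝕊 2) × 𝔼 2} (h : b.1 ≠ northPole) :
    toModel b = Φ₁ (zeta b.1, toC b.2) := by
  rw [toModel, if_neg h]

/-- `toModel` over the north pole. [folklore] -/
theorem toModel_of_eq_northPole {b : (𝕊 2) × 𝔼 2} (h : b.1 = northPole) :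
    toModel b = Φ₃ (0, toC b.2) := by
  rw [toModel, if_pos h]

/-- **`toModel` in the third chart**: off the south pole and off the central fibre,
`toModel (x, w) = Φ₃ (ξ(x)/w, w)`. [folklore] -/
theorem toModel_of_ne_southPole {b : (𝕊 2) × 𝔼 2} (hS : b.1 ≠ southPole) (hw : b.2 ≠ 0) :
    toModel b = Φ₃ (xi b.1 * (toC b.2)⁻¹, toC b.2) := by
  have hw' : toC b.2 ≠ 0 := (toC_eq_zero_iff _).not.2 hw
  by_cases hN : b.1 = northPole
  · rw [toModel_of_eq_northPole hN, hN, xi_northPole, zero_mul]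
  · have hz : zeta b.1 ≠ 0 := (zeta_eq_zero_iff hN).not.2 hS
    rw [toModel_of_ne_northPole hN, Φ₁_eq_Φ₃ (p := (zeta b.1, toC b.2)) hz hw']
    dsimp only
    rw [mul_inv, xi_eq_inv_zeta hN hS]

/-- The blow-down map on `U₁ ∪ U₂`. [folklore] -/
def blowDown₁₂ : V₁₂ → (𝕊 2) × 𝔼 2 :=
  data₁₂.lift (fun p => (invZeta p.1, planeR p.2)) (fun p => (invXi p.1, planeR (p.1 * p.2))) (by
    rintro ⟨z, w⟩ hz
    change z ≠ 0 at hz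
    change (invZeta z, planeR w) = (invXi z⁻¹, planeR (z⁻¹ * (z * w)))
    rw [invZeta_eq_invXi_inv hz, inv_mul_cancel_left₀ hz])

/-- **The blow-down map** `π : Ṽ → 𝕊 2 × ℝ²`: `Φ₁ (z, w) ↦ (invZeta z, w)`,
`Φ₂ (u, m) ↦ (invXi u, u m)`, `Φ₃ (k, w) ↦ (invXi (k w), w)`. [folklore] -/
def blowDown : Model → (𝕊 2) × 𝔼 2 :=
  data₃.lift blowDown₁₂ (fun q => (invXi (q.1 * q.2), planeR q.2)) (by
    rintro x ⟨⟨u, m⟩, hm, rfl⟩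
    change m ≠ 0 at hm
    change (invXi u, planeR (u * m)) = (invXi (m⁻¹ * (m * u)), planeR (m * u))
    rw [inv_mul_cancel_left₀ hm, mul_comm])

/-- The blow-down map on the first chart. [folklore] -/
@[simp] theorem blowDown_Φ₁ (p : ℂ × ℂ) : blowDown (Φ₁ p) = (invZeta p.1, planeR p.2) := rfl

/-- The blow-down map on the second chart. [folklore] -/
@[simp] theorem blowDown_Φ₂ (p : ℂ × ℂ) : blowDown (Φ₂ p) = (invXi p.1, planeR (p.1 * p.2)) := rfl

/-- The blow-down map on the third chart. [folklore] -/
@[simp] theorem blowDown_Φ₃ (p : ℂ × ℂ) : blowDown (Φ₃ p) = (invXi (p.1 * p.2), planeR p.2) :=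
  rfl

/-- **The blow-down map is smooth.** [folklore] -/
theorem contMDiff_blowDown : ContMDiff 𝓘(ℝ, ℂ × ℂ) ((𝓡 2).prod 𝓘(ℝ, 𝔼 2)) ∞ blowDown := by
  have h1 : ContMDiff 𝓘(ℝ, ℂ × ℂ) ((𝓡 2).prod 𝓘(ℝ, 𝔼 2)) ∞
      fun p : ℂ × ℂ => (invZeta p.1, planeR p.2) :=
    (contMDiff_invZeta.comp contDiff_fst.contMDiff).prodMk
      (contDiff_planeR.comp contDiff_snd).contMDiff
  have h2 : ContMDiff 𝓘(ℝ, ℂ × ℂ) ((𝓡 2).prod 𝓘(ℝ, 𝔼 2)) ∞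
      fun p : ℂ × ℂ => (invXi p.1, planeR (p.1 * p.2)) :=
    (contMDiff_invXi.comp contDiff_fst.contMDiff).prodMk
      (contDiff_planeR.comp (contDiff_fst.mul contDiff_snd)).contMDiff
  have h3 : ContMDiff 𝓘(ℝ, ℂ × ℂ) ((𝓡 2).prod 𝓘(ℝ, 𝔼 2)) ∞
      fun q : ℂ × ℂ => (invXi (q.1 * q.2), planeR q.2) :=
    (contMDiff_invXi.comp (contDiff_fst.mul contDiff_snd).contMDiff).prodMk
      (contDiff_planeR.comp contDiff_snd).contMDiff
  exact data₃.contMDiff_lift (data₁₂.contMDiff_lift h1 h2) h3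

/-- The blow-down map is continuous. [folklore] -/
theorem continuous_blowDown : Continuous blowDown := contMDiff_blowDown.continuous

/-- **`blowDown ∘ toModel = id` off the blown-up point.** [folklore] -/
theorem blowDown_toModel {b : (𝕊 2) × 𝔼 2} (hb : b ≠ basePt) : blowDown (toModel b) = b := by
  obtain ⟨x, w⟩ := b
  by_cases hN : x = northPole
  · subst hN
    rw [toModel_of_eq_northPole rfl, blowDown_Φ₃]
    simp
  · rw [toModel_of_ne_northPole hN, blowDown_Φ₁]
    simp [invZeta_zeta hN]

/-- `toModel` is injective off the blown-up point. [folklore] -/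
theorem toModel_injOn : InjOn toModel {b | b ≠ basePt} := fun b hb b' hb' h => by
  rw [← blowDown_toModel hb, ← blowDown_toModel hb', h]

/-- **The exceptional curve** `E = {u = 0} ⊆ U₂ ∪ {w = 0} ⊆ U₃` (a copy of `ℂℙ¹`). [folklore] -/
def excep : Set Model := Φ₂ '' {q | q.1 = 0} ∪ Φ₃ '' {q | q.2 = 0}

/-- The blow-down map collapses the exceptional curve to the blown-up point. [folklore] -/
theorem blowDown_of_mem_excep {v : Model} (hv : v ∈ excep) : blowDown v = basePt := by
  rcases hv with ⟨q, hq, rfl⟩ | ⟨q, hq, rfl⟩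
  · change q.1 = 0 at hq
    rw [blowDown_Φ₂, hq, zero_mul, invXi_zero, planeR_zero]; rfl
  · change q.2 = 0 at hq
    rw [blowDown_Φ₃, hq, mul_zero, invXi_zero, planeR_zero]; rfl

/-- Every point of the model is in the image of `B ∖ {p}` or on the exceptional curve.
[folklore] -/
theorem exists_toModel_eq_or_mem_excep (v : Model) : (∃ b ≠ basePt, toModel b = v) ∨ v ∈ excep := by
  rcases exists_Φ_eq v with ⟨⟨z, w⟩, rfl⟩ | ⟨⟨u, m⟩, rfl⟩ | ⟨⟨k, w⟩, rfl⟩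
  · refine Or.inl ⟨(invZeta z, planeR w), fun h => invZeta_ne_northPole z (congrArg Prod.fst h), ?_⟩
    rw [toModel_of_ne_northPole (invZeta_ne_northPole z)]
    simp
  · by_cases hu : u = 0
    · exact Or.inr (Or.inl ⟨(u, m), hu, rfl⟩)
    · refine Or.inl ⟨(invZeta u⁻¹, planeR (u * m)), fun h =>
        invZeta_ne_northPole _ (congrArg Prod.fst h), ?_⟩
      rw [toModel_of_ne_northPole (invZeta_ne_northPole _), Φ₁_eq_Φ₂ (p := (zeta _, _))]
      · simp [τ₁₂, inv_mul_cancel_left₀ hu]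
      · simpa using hu
  · by_cases hw : w = 0
    · exact Or.inr (Or.inr ⟨(k, w), hw, rfl⟩)
    by_cases hk : k = 0
    · subst hk
      refine Or.inl ⟨(northPole, planeR w), fun h => hw ?_, ?_⟩
      · have := congrArg Prod.snd h
        simpa [basePt] using congrArg toC this
      · rw [toModel_of_eq_northPole rfl]; simp
    · refine Or.inl ⟨(invZeta (k * w)⁻¹, planeR w), fun h =>
        invZeta_ne_northPole _ (congrArg Prod.fst h), ?_⟩
      rw [toModel_of_ne_northPole (invZeta_ne_northPole _),
        Φ₁_eq_Φ₃ (p := (zeta (invZeta (k * w)⁻¹), toC (planeR w)))]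
      · simp only [zeta_invZeta, toC_planeR]
        rw [mul_inv_rev, inv_inv, mul_comm k w, inv_mul_cancel_left₀ hw]
      · simp [hk, hw]
      · simpa using hw

/-- **The exceptional curve is the fibre of the blow-down map over `p`.** [folklore] -/
theorem blowDown_eq_basePt_iff (v : Model) : blowDown v = basePt ↔ v ∈ excep := by
  refine ⟨fun h => ?_, blowDown_of_mem_excep⟩
  rcases exists_toModel_eq_or_mem_excep v with ⟨b, hb, rfl⟩ | hv
  · exact absurd ((blowDown_toModel hb).symm.trans h) hb
  · exact hv

/-- The exceptional curve as a preimage. [folklore] -/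
theorem excep_eq_preimage : excep = blowDown ⁻¹' {basePt} :=
  Set.ext fun v => (blowDown_eq_basePt_iff v).symm

/-- The exceptional curve is closed. [folklore] -/
theorem isClosed_excep : IsClosed excep := by
  rw [excep_eq_preimage]
  exact isClosed_singleton.preimage continuous_blowDown

/-- Points of `B ∖ {p}` do not map to the exceptional curve. [folklore] -/
theorem toModel_not_mem_excep {b : (𝕊 2) × 𝔼 2} (hb : b ≠ basePt) : toModel b ∉ excep := fun h =>
  hb ((blowDown_toModel hb).symm.trans (blowDown_of_mem_excep h))

/-- **`toModel ∘ blowDown = id` off the exceptional curve.** [folklore] -/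
theorem toModel_blowDown {v : Model} (hv : v ∉ excep) : toModel (blowDown v) = v := by
  rcases exists_toModel_eq_or_mem_excep v with ⟨b, hb, rfl⟩ | h
  · rw [blowDown_toModel hb]
  · exact absurd h hv

/-- The image of `B ∖ {p}` is the complement of the exceptional curve. [folklore] -/
theorem image_toModel : toModel '' {b | b ≠ basePt} = excepᶜ := by
  ext v
  constructor
  · rintro ⟨b, hb, rfl⟩
    exact toModel_not_mem_excep hb
  · intro hv
    exact ⟨blowDown v, fun h => hv ((blowDown_eq_basePt_iff v).1 h), toModel_blowDown hv⟩

/-! ### Smoothness of `toModel` and the partial homeomorphism `B ∖ {p} ≅ Ṽ ∖ E` -/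

/-- The first chart expression of `toModel` is smooth off the north pole. [folklore] -/
theorem contMDiffAt_toModel_chart₁ {b : (𝕊 2) × 𝔼 2} (hN : b.1 ≠ northPole) :
    ContMDiffAt ((𝓡 2).prod 𝓘(ℝ, 𝔼 2)) 𝓘(ℝ, ℂ × ℂ) ∞
      (fun b' : (𝕊 2) × 𝔼 2 => Φ₁ (zeta b'.1, toC b'.2)) b := by
  have h1 : ContMDiffAt ((𝓡 2).prod 𝓘(ℝ, 𝔼 2)) 𝓘(ℝ, ℂ) ∞ (fun b' : (𝕊 2) × 𝔼 2 => zeta b'.1) b :=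
    (contMDiffAt_zeta hN).comp b contMDiffAt_fst
  have h2 : ContMDiff ((𝓡 2).prod 𝓘(ℝ, 𝔼 2)) 𝓘(ℝ, ℂ) ∞ (fun b' : (𝕊 2) × 𝔼 2 => toC b'.2) :=
    contDiff_toC.comp_contMDiff contMDiff_snd
  exact contMDiff_Φ₁.contMDiffAt.comp b (h1.prodMk_space h2.contMDiffAt)

/-- The third chart expression of `toModel` is smooth off the south pole and the central fibre.
[folklore] -/
theorem contMDiffAt_toModel_chart₃ {b : (𝕊 2) × 𝔼 2} (hS : b.1 ≠ southPole) (hw : b.2 ≠ 0) :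
    ContMDiffAt ((𝓡 2).prod 𝓘(ℝ, 𝔼 2)) 𝓘(ℝ, ℂ × ℂ) ∞
      (fun b' : (𝕊 2) × 𝔼 2 => Φ₃ (xi b'.1 * (toC b'.2)⁻¹, toC b'.2)) b := by
  have h1 : ContMDiffAt ((𝓡 2).prod 𝓘(ℝ, 𝔼 2)) 𝓘(ℝ, ℂ) ∞ (fun b' : (𝕊 2) × 𝔼 2 => xi b'.1) b :=
    (contMDiffAt_xi hS).comp b contMDiffAt_fst
  have h2 : ContMDiff ((𝓡 2).prod 𝓘(ℝ, 𝔼 2)) 𝓘(ℝ, ℂ) ∞ (fun b' : (𝕊 2) × 𝔼 2 => toC b'.2) :=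
    contDiff_toC.comp_contMDiff contMDiff_snd
  have h3 := contMDiffAt_mul_complex h1 (contMDiffAt_inv_complex h2.contMDiffAt
    ((toC_eq_zero_iff _).not.2 hw))
  exact contMDiff_Φ₃.contMDiffAt.comp b (h3.prodMk_space h2.contMDiffAt)

/-- **`toModel` is smooth off the blown-up point**: near a point off the north pole it is the
first chart expression, near a point over the north pole (hence off the central fibre) the third.
[folklore] -/
theorem contMDiffAt_toModel {b : (𝕊 2) × 𝔼 2} (hb : b ≠ basePt) :
    ContMDiffAt ((𝓡 2).prod 𝓘(ℝ, 𝔼 2)) 𝓘(ℝ, ℂ × ℂ) ∞ toModel b := by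
  by_cases hN : b.1 = northPole
  · have hw : b.2 ≠ 0 := by
      rintro hw
      apply hb
      exact Prod.ext hN hw
    have hS : b.1 ≠ southPole := by rw [hN]; exact northPole_ne_southPole
    have ho : IsOpen {b' : (𝕊 2) × 𝔼 2 | b'.1 ≠ southPole ∧ b'.2 ≠ 0} :=
      (isOpen_ne.preimage continuous_fst).inter (isOpen_ne.preimage continuous_snd)
    have hev : toModel =ᶠ[𝓝 b] fun b' : (𝕊 2) × 𝔼 2 =>
        Φ₃ (xi b'.1 * (toC b'.2)⁻¹, toC b'.2) := by
      filter_upwards [ho.mem_nhds ⟨hS, hw⟩] with b' hb'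
      exact toModel_of_ne_southPole hb'.1 hb'.2
    exact (contMDiffAt_toModel_chart₃ hS hw).congr_of_eventuallyEq hev
  · have ho : IsOpen {b' : (𝕊 2) × 𝔼 2 | b'.1 ≠ northPole} := isOpen_ne.preimage continuous_fst
    have hev : toModel =ᶠ[𝓝 b] fun b' : (𝕊 2) × 𝔼 2 => Φ₁ (zeta b'.1, toC b'.2) := by
      filter_upwards [ho.mem_nhds hN] with b' hb'
      exact toModel_of_ne_northPole hb'
    exact (contMDiffAt_toModel_chart₁ hN).congr_of_eventuallyEq hev

/-- `toModel` is smooth on `B ∖ {p}`. [folklore] -/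
theorem contMDiffOn_toModel :
    ContMDiffOn ((𝓡 2).prod 𝓘(ℝ, 𝔼 2)) 𝓘(ℝ, ℂ × ℂ) ∞ toModel {b | b ≠ basePt} := fun _ hb =>
  (contMDiffAt_toModel hb).contMDiffWithinAt

/-- `toModel` is continuous on `B ∖ {p}`. [folklore] -/
theorem continuousOn_toModel : ContinuousOn toModel {b : (𝕊 2) × 𝔼 2 | b ≠ basePt} :=
  contMDiffOn_toModel.continuousOn

/-- **`B ∖ {p} ≅ Ṽ ∖ E`** as an open partial homeomorphism of `B` to the model: `toModel` with
inverse the blow-down map. [folklore] -/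
def toModelPH : OpenPartialHomeomorph ((𝕊 2) × 𝔼 2) Model where
  toFun := toModel
  invFun := blowDown
  source := {b | b ≠ basePt}
  target := excepᶜ
  map_source' _ hb := toModel_not_mem_excep hb
  map_target' v hv h := hv ((blowDown_eq_basePt_iff v).1 h)
  left_inv' _ hb := blowDown_toModel hb
  right_inv' _ hv := toModel_blowDown hv
  open_source := isOpen_ne
  open_target := isClosed_excep.isOpen_compl
  continuousOn_toFun := continuousOn_toModel
  continuousOn_invFun := continuous_blowDown.continuousOn

/-- The partial homeomorphism is `toModel`. [folklore] -/
@[simp] theorem toModelPH_apply (b : (𝕊 2) × 𝔼 2) : toModelPH b = toModel b := rfl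

/-- Its inverse is the blow-down map. [folklore] -/
@[simp] theorem toModelPH_symm_apply (v : Model) : toModelPH.symm v = blowDown v := rfl

/-- Its source is `B ∖ {p}`. [folklore] -/
@[simp] theorem toModelPH_source : toModelPH.source = {b : (𝕊 2) × 𝔼 2 | b ≠ basePt} := rfl

/-- Its target is the complement of the exceptional curve. [folklore] -/
@[simp] theorem toModelPH_target : toModelPH.target = excepᶜ := rfl

/-- `toModelPH` is smooth on its source. [folklore] -/
theorem contMDiffOn_toModelPH :
    ContMDiffOn ((𝓡 2).prod 𝓘(ℝ, 𝔼 2)) 𝓘(ℝ, ℂ × ℂ) ∞ toModelPH toModelPH.source :=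
  contMDiffOn_toModel

/-- `toModelPH.symm` is smooth (everywhere, in particular on the target). [folklore] -/
theorem contMDiffOn_toModelPH_symm :
    ContMDiffOn 𝓘(ℝ, ℂ × ℂ) ((𝓡 2).prod 𝓘(ℝ, 𝔼 2)) ∞ toModelPH.symm toModelPH.target :=
  contMDiff_blowDown.contMDiffOn

/-- `toModel` is an open map on `B ∖ {p}`: it maps open subsets of `B ∖ {p}` to open sets.
[folklore] -/
theorem isOpen_image_toModel {s : Set ((𝕊 2) × 𝔼 2)} (hs : IsOpen s) (hsp : basePt ∉ s) :
    IsOpen (toModel '' s) :=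
  toModelPH.isOpen_image_of_subset_source hs fun _ hb h => hsp (h ▸ hb)

/-! ### The involution and the Möbius twist of `B` -/

/-- **The fibrewise Möbius involution of `B = 𝕊 2 × ℝ²`**: `(x, w) ↦ (moebius w x, w)` with
`w` read as the complex number `w₀ + i w₁`, i.e. `ζ ↦ (w ζ)⁻¹` in the fibre over `w` (junk over
`w = 0`). [folklore] -/
def twistB (b : (𝕊 2) × 𝔼 2) : (𝕊 2) × 𝔼 2 := (moebius (toC b.2) b.1, b.2)

/-- The second component of `twistB`. [folklore] -/
@[simp] theorem twistB_snd (b : (𝕊 2) × 𝔼 2) : (twistB b).2 = b.2 := rfl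

/-- The first component of `twistB`. [folklore] -/
theorem twistB_fst (b : (𝕊 2) × 𝔼 2) : (twistB b).1 = moebius (toC b.2) b.1 := rfl

/-- `twistB` is an involution off the central fibre. [folklore] -/
theorem twistB_twistB {b : (𝕊 2) × 𝔼 2} (hw : b.2 ≠ 0) : twistB (twistB b) = b := by
  obtain ⟨x, w⟩ := b
  have hc : toC w ≠ 0 := (toC_eq_zero_iff w).not.2 hw
  simp only [twistB]
  rw [moebius_moebius hc]

/-- `twistB b` is never the blown-up point when `b` is off the central fibre. [folklore] -/
theorem twistB_ne_basePt {b : (𝕊 2) × 𝔼 2} (hw : b.2 ≠ 0) : twistB b ≠ basePt := fun h =>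
  hw (congrArg Prod.snd h)

/-- **The monomial involution is the Möbius twist off the central fibre**:
`Ψ (toModel (x, w)) = toModel (moebius w x, w)` for `w ≠ 0`. [folklore] -/
theorem Ψ_toModel {b : (𝕊 2) × 𝔼 2} (hw : b.2 ≠ 0) : Ψ (toModel b) = toModel (twistB b) := by
  obtain ⟨x, w⟩ := b
  change w ≠ 0 at hw
  have hc : toC w ≠ 0 := (toC_eq_zero_iff w).not.2 hw
  by_cases hN : x = northPole
  · -- `Φ₃ (0, w) ↦ Φ₁ (0, w) = toModel (S, w)`
    subst hN
    rw [toModel_of_eq_northPole rfl, Ψ_Φ₃, twistB, toModel_of_ne_northPole]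
    · simp
    · change moebius (toC w) northPole ≠ northPole
      rw [moebius_northPole]; exact northPole_ne_southPole.symm
  by_cases hS : x = southPole
  · -- `Φ₁ (0, w) ↦ Φ₃ (0, w) = toModel (N, w)`
    subst hS
    rw [toModel_of_ne_northPole hN, Ψ_Φ₁, twistB, toModel_of_eq_northPole]
    · simp
    · exact moebius_southPole _
  · -- generic fibre point: `Φ₁ (ζ, w) ↦ Φ₃ (ζ, w) = Φ₁ ((ζ w)⁻¹, w) = toModel (moebius w x, w)`
    have hz : zeta x ≠ 0 := (zeta_eq_zero_iff hN).not.2 hS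
    have hN' : moebius (toC w) x ≠ northPole := (moebius_eq_northPole_iff hc x).not.2 hS
    have hS' : moebius (toC w) x ≠ southPole := (moebius_eq_southPole_iff hc x).not.2 hN
    rw [toModel_of_ne_northPole hN, Ψ_Φ₁_of_ne_zero (p := (zeta x, toC w)) hz hc, twistB,
      toModel_of_ne_northPole hN']
    dsimp only
    rw [zeta_moebius hc hN hS]

/-- **Gluck's rotation straightens the Möbius twist**: `gluckMap (twistB (x, w)) =
(moebius ‖w‖ x, w)` for `w ≠ 0` — after rotating the fibre over `w` by `w/‖w‖` (Gluck's `τ`),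
the twisted point has `ζ`-coordinate `ξ(x)/‖w‖`, the half-turn of `x` dilated by `‖w‖⁻¹`.
[cite: GluckTAMS1962, §8] -/
theorem gluckMap_twistB {b : (𝕊 2) × 𝔼 2} (hw : b.2 ≠ 0) :
    gluckMap (twistB b) = (moebius (‖b.2‖ : ℂ) b.1, b.2) := by
  obtain ⟨x, w⟩ := b
  change w ≠ 0 at hw
  rw [twistB, gluckMap_apply_of_ne_zero _ hw]
  dsimp only
  rw [show toC w = ⟨w 0, w 1⟩ from rfl, rotateSphereTwo_unitVector_moebius w hw x]

end ToricBlowup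

end Literature.Topology.FourManifolds
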